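import Summits.AtomisticToContinuum.HydrodynamicLimit.Theorems.StiffCollisionalRelaxationAprioriBoundsMesoPartTwoOfMeanVariance
import Summits.AtomisticToContinuum.HydrodynamicLimit.Theorems.StiffCollisionalRelaxationAprioriBoundsMesoPartOneOfVarianceTails
import Summits.AtomisticToContinuum.HydrodynamicLimit.Theorems.StiffCollisionalRelaxationAprioriBoundsMesoMeanFloorOfKRC
import Summits.AtomisticToContinuum.HydrodynamicLimit.Theorems.StiffCollisionalRelaxationAprioriBoundsMesoMeanCeilingDock
import Summits.AtomisticToContinuum.HydrodynamicLimit.Theorems.StiffCollisionalRelaxationAprioriBoundsFibreFarTailAllPreShock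
import HarnessLib

/-!
# Line `meso-chebyshev-window` (crux `AprioriBounds`, stmt-AtomisticToContinuum-14827): the capstones

Support file (`--supports stmt-AtomisticToContinuum-14827`) of the lead prover of the line
(`prover-line-stmt-AtomisticToContinuum-14827-a2-0`, skeleton r1, wave 2).  The crux decl
`StiffCollisionalRelaxation.AprioriBounds` (= `CollisionIsometryCLT.AprioriBoundsPreShock`, one `Prop`,
`AprioriBoundsNegative.aprioriBoundsPreShock_iff`) unfolds (`aprioriBounds_iff`) to: crux prefix →
`PartOneAt ∧ PartTwoAt`.  The line's skeleton (`Cruxes/AprioriBounds/Lines/meso_chebyshev_window.lean`, never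
imported) composes its seven registered stubs into the crux BY NAME; its two provable stubs are landed theorems of
this namespace (`stub_partTwo_of_meanVariance`, p145137 — the mesoscopic Chebyshev window; `stub_partOne_of_varianceTails`,
p145949 — Chebyshev at each level ∘ the λ-dial).  This file is the IMPORTABLE form of the skeleton's compositions, with
the five OPEN registered stubs (`stub_meanFloor`, `stub_meanCeiling`, `stub_mesoVariance`, `stub_farTailAll`,
`stub_occupationVariance`) written out verbatim as hypotheses, so that any future producer of a stub plugs in with
one application:

* `partTwo_of_meanBands_mesoVariance` (registered anchor) — component (ii) WITHOUT `KineticRangeControl` (stmt-9201): floor in the mean ∧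
  ceiling in the mean ∧ Poisson-order variance ⟹ `PartTwoAt` under the crux prefix (the line's distinctive re-cut of
  (ii); the bounded-energy event of the window lemma is supplied by the crux's own `t = 0` LLN, `energyBound_of_lln`).
* `partOne_of_farTailAll_occupationVariance` (registered anchor) — component (i): far tails in the mean (`FarTailAllAt`) ∧ vanishing
  variances of the time-integrated tail occupations ⟹ `PartOneAt` under the crux prefix.
* `aprioriBounds_of_partOne_partTwo` — the two components under the crux prefix give the crux (thresholds by `min`).
* `AprioriBounds_of_meso_stubs` — THE SKELETON THEOREM, importable: the five open stubs ⟹ `AprioriBounds` (two lines over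
  the two registered component anchors above); `AprioriBoundsPreShock_of_meso_stubs` its `CollisionIsometryCLT` twin.
* `AprioriBounds_of_KRC_GT_occupationVariance` (registered anchor) — THE MINIMAL-IMPORT CAPSTONE: the crux from the
  two PRE-SHOCK-guarded open items `GermanoSplitLES.KineticRangeControl` (stmt-9201, ⟹ (ii) by the landed
  `AdiabatCeiling.partTwo_of_kineticRangeControl`) and `UGibbsSRBRigidity.GaussianTails` (stmt-14415, ⟹ `FarTailAllAt`
  by the landed `FibreDeficitTransfer.farTailAll_of_gaussianTails`) and ONE new rate-free concentration statement,
  the occupation-variance stub; it supersedes `FibreDeficitTransfer.AprioriBounds_of_KRC_GT_HLPB` (p137042), whose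
  third hypothesis `ImplosionDichotomy.HydroLimitProfilewiseBand` (stmt-17372) is the per-profile CONJUNCT.
* `AprioriBounds_of_KRC_GT_mesoVariance_occupationVariance` — the same with (ii) routed through the line's own
  (ii)-chain: the two mean bands are 9201-weak (landed docks `meanFloor_of_kineticRangeControl`,
  `meanCeiling_of_kineticRangeControl`), so 9201 ∧ 14415 ∧ mesoVariance ∧ occupationVariance ⟹ the crux
  (dominated by the previous capstone; it documents that the bands cost nothing beyond 9201).

Hypotheses that are Theses `def : Prop` (`KineticRangeControl`, `GaussianTails`) make the last three theorems
conditional by design.  No new definitions; no `sorry`; axioms `propext`, `Classical.choice`, `Quot.sound`.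
-/

noncomputable section

open MeasureTheory ProbabilityTheory Filter Set Topology
open scoped ENNReal

namespace Summit.AtomisticToContinuum.HydrodynamicLimit.Theorems.MesoChebyshevWindow

open Literature.MathematicalPhysics.KineticTheory Literature.Analysis.FluidPDE
open Summit.AtomisticToContinuum.HydrodynamicLimit.Theorems.AprioriBoundsNegative (PartOneAt PartTwoAt)
open Summit.AtomisticToContinuum.HydrodynamicLimit.Theorems.VisitLedgerUpscattering (Cfg Flow Flows NiceProfiles)
open Summit.AtomisticToContinuum.HydrodynamicLimit.Theorems.FibreDeficitTransfer

/-! ## Glue: the bounded-energy event and the two-component assembly -/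

/-- **Bounded energy per sphere at time `0`, from the crux's own `t = 0` LLN.**  The third component of
`TendstoHydroFieldsAt … 0` at the test function `χ ≡ 1`, `δ = 1`: with `E₀ := ∫ E(0,·) + 1`,
`P_N{E₀ < (N+1)⁻¹ ∑ᵢ |vᵢ(0)|²/2} → 0` (the bounded-energy hypothesis of `stub_partTwo_of_meanVariance`). -/
theorem energyBound_of_lln {σ : ℝ} {a₀ θ₀ : T3 → ℝ} {u₀ : T3 → V3}
    {Φ : (N : ℕ) → HardSphereFlow (Torus.geometry (Fin 3)) (hsDiameter σ N) (N + 1)}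
    {ρ θ : ℝ → T3 → ℝ} {u : ℝ → T3 → V3}
    (h : TendstoHydroFieldsAt (fun N => localGibbsLaw σ a₀ u₀ θ₀ N (Φ N)) Φ ρ u θ 0) :
    ∃ E₀ : ℝ, Tendsto (fun N : ℕ => localGibbsLaw σ a₀ u₀ θ₀ N (Φ N)
      {z | E₀ < empiricalEnergyField ((Φ N).flow 0 z) (fun _ => 1)}) atTop (𝓝 0) := by
  refine ⟨(∫ x, (fun _ : T3 => (1 : ℝ)) x * totalEnergyDensity (ρ 0 x) (u 0 x) (θ 0 x)) + 1, ?_⟩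
  have h1 := ((h (fun _ => (1 : ℝ)) continuous_const 1 one_pos).2).2
  refine tendsto_of_tendsto_of_tendsto_of_le_of_le tendsto_const_nhds h1 (fun _ => zero_le) ?_
  intro N
  refine measure_mono fun z hz => ?_
  simp only [Set.mem_setOf_eq] at hz ⊢
  exact lt_abs.2 (Or.inl (by linarith))

/-- **The crux from its two components under the crux prefix.**  If component (i) (`PartOneAt`) and component
(ii) (`PartTwoAt`) each hold under the crux prefix with their own thresholds `(σ₀, η₁)`, then
`StiffCollisionalRelaxation.AprioriBounds` holds BY NAME, with `σ₀ := min σ_(i) σ_(ii)`, `η₁ := min η_(i) η_(ii)`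
(`AprioriBoundsNegative.aprioriBounds_iff`). -/
theorem aprioriBounds_of_partOne_partTwo
    (hI :
    ∀ (a₀ θ₀ : T3 → ℝ) (u₀ : T3 → V3), Continuous a₀ → Continuous θ₀ → Continuous u₀ →
      (∀ x, 0 < a₀ x) → (∀ x, 0 < θ₀ x) →
      ∃ σ₀ : ℝ, 0 < σ₀ ∧ ∃ η₁ : ℝ, 0 < η₁ ∧ ∀ σ : ℝ, 0 < σ → σ < σ₀ →
        ∀ (T : ℝ) (ρ θ : ℝ → T3 → ℝ) (u : ℝ → T3 → V3), IsHardSphereEulerSolution σ T ρ u θ →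
        ∀ Φ : (N : ℕ) → HardSphereFlow (Torus.geometry (Fin 3)) (hsDiameter σ N) (N + 1),
          TendstoHydroFieldsAt (fun N => localGibbsLaw σ a₀ u₀ θ₀ N (Φ N)) Φ ρ u θ 0 →
          ∀ t : ℝ, 0 < t → t < T → (∀ s ∈ Icc 0 t, ∀ x, 2 * ρ s x * σ ^ 3 < η₁) →
            PartOneAt σ a₀ θ₀ u₀ Φ t)
    (hII :
    ∀ (a₀ θ₀ : T3 → ℝ) (u₀ : T3 → V3), Continuous a₀ → Continuous θ₀ → Continuous u₀ →
      (∀ x, 0 < a₀ x) → (∀ x, 0 < θ₀ x) →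
      ∃ σ₀ : ℝ, 0 < σ₀ ∧ ∃ η₁ : ℝ, 0 < η₁ ∧ ∀ σ : ℝ, 0 < σ → σ < σ₀ →
        ∀ (T : ℝ) (ρ θ : ℝ → T3 → ℝ) (u : ℝ → T3 → V3), IsHardSphereEulerSolution σ T ρ u θ →
        ∀ Φ : (N : ℕ) → HardSphereFlow (Torus.geometry (Fin 3)) (hsDiameter σ N) (N + 1),
          TendstoHydroFieldsAt (fun N => localGibbsLaw σ a₀ u₀ θ₀ N (Φ N)) Φ ρ u θ 0 →
          ∀ t : ℝ, 0 < t → t < T → (∀ s ∈ Icc 0 t, ∀ x, 2 * ρ s x * σ ^ 3 < η₁) →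
            PartTwoAt σ a₀ θ₀ u₀ Φ t) :
    Summit.AtomisticToContinuum.HydrodynamicLimit.Theses.StiffCollisionalRelaxation.AprioriBounds := by
  rw [AprioriBoundsNegative.aprioriBounds_iff]
  intro a₀ θ₀ u₀ ha hθ hu ha0 hθ0
  obtain ⟨σ₁, hσ₁, η₁', hη₁', HI⟩ := hI a₀ θ₀ u₀ ha hθ hu ha0 hθ0
  obtain ⟨σ₂, hσ₂, η₂', hη₂', HII⟩ := hII a₀ θ₀ u₀ ha hθ hu ha0 hθ0
  refine ⟨min σ₁ σ₂, lt_min hσ₁ hσ₂, min η₁' η₂', lt_min hη₁' hη₂', ?_⟩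
  intro σ hσ hσlt T ρ θ u hsol Φ hLLN t ht htT hdil
  simp only [lt_min_iff] at hσlt hdil
  exact ⟨HI σ hσ hσlt.1 T ρ θ u hsol Φ hLLN t ht htT (fun s hs x => (hdil s hs x).1),
    HII σ hσ hσlt.2 T ρ θ u hsol Φ hLLN t ht htT (fun s hs x => (hdil s hs x).2)⟩

/-! ## Component (ii) without 9201: mean bands and Poisson-order variance -/

/-- **Component (ii) under the crux prefix from the three OPEN (ii)-stubs of the line** (registered anchor
`partTwo_of_meanBands_mesoVariance`) — `stub_meanFloor` (a floor
`m ≤ E ρ̄_φ(s,x)` in the mean), `stub_meanCeiling` (a ceiling `E ρ̄_φ(s,x) σ³ ≤ κ < 1` in the mean) and `stub_mesoVariance`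
(Poisson-order variance `Var ρ̄_φ(s,x) ≤ A (N+1)^{3γ−1}`), all uniform on `[0,t] × 𝕋³` and written out verbatim as
hypotheses — through the LANDED mesoscopic Chebyshev window `stub_partTwo_of_meanVariance` (p145137), whose bounded-energy
event is supplied by `energyBound_of_lln`.  Thresholds `σ₀ := min (min σ₁ σ₂) (min σ₃ (1/2))`, `η₁ := min (min η₁ η₂) η₃`.
This is the line's re-cut of (ii): no import of `KineticRangeControl`. -/
theorem partTwo_of_meanBands_mesoVariance : (∀ (a₀ θ₀ : T3 → ℝ) (u₀ : T3 → V3), Continuous a₀ → Continuous θ₀ → Continuous u₀ → (∀ x, 0 < a₀ x) → (∀ x, 0 < θ₀ x) → ∃ σ₀ : ℝ, 0 < σ₀ ∧ ∃ η₁ : ℝ, 0 < η₁ ∧ ∀ σ : ℝ, 0 < σ → σ < σ₀ → ∀ (T : ℝ) (ρ θ : ℝ → T3 → ℝ) (u : ℝ → T3 → V3), IsHardSphereEulerSolution σ T ρ u θ → ∀ Φ : (N : ℕ) → HardSphereFlow (Torus.geometry (Fin 3)) (hsDiameter σ N) (N + 1), TendstoHydroFieldsAt (fun N => localGibbsLaw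 σ a₀ u₀ θ₀ N (Φ N)) Φ ρ u θ 0 → ∀ t : ℝ, 0 < t → t < T → (∀ s ∈ Icc 0 t, ∀ x, 2 * ρ s x * σ ^ 3 < η₁) → ∀ (γ C : ℝ) (φ : ℕ → T3 → ℝ), 0 < γ → γ ≤ 1 / 15 → ((∀ N, Literature.Analysis.FunctionSpaces.Torus.IsSmooth (φ N)) ∧ (∀ N y, 0 ≤ φ N y) ∧ (∀ N, ∫ y, φ N y = 1) ∧ (∀ (N : ℕ) y, ((N : ℝ) + 1) ^ (-γ) ≤ Torus.euclidDist y 0 → φ N y = 0) ∧ (∀ (N : ℕ) y, φ N y ≤ C * ((N : ℝ) + 1) ^ (3 * γ)) ∧ (∀ (N : ℕ) y, ‖Literature.Analysis.FunctionSpaces.Torus.gradient (φ N) y‖ ≤ C * ((N : ℝ) + 1) ^ (4 * γ))) → ∃ m : ℝ, 0 < m ∧ ∃ N₀ : ℕ, ∀ N : ℕ, N₀ ≤ N → ∀ s ∈ Icc 0 t, ∀ x : T3, m ≤ ∫ z, empiricalDensityField ((Φ N).flow s z) (fun y => φ N (y - x)) ∂(localGibbsLaw σ a₀ u₀ θ₀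 N (Φ N))) → (∀ (a₀ θ₀ : T3 → ℝ) (u₀ : T3 → V3), Continuous a₀ → Continuous θ₀ → Continuous u₀ → (∀ x, 0 < a₀ x) → (∀ x, 0 < θ₀ x) → ∃ σ₀ : ℝ, 0 < σ₀ ∧ ∃ η₁ : ℝ, 0 < η₁ ∧ ∀ σ : ℝ, 0 < σ → σ < σ₀ → ∀ (T : ℝ) (ρ θ : ℝ → T3 → ℝ) (u : ℝ → T3 → V3), IsHardSphereEulerSolution σ T ρ u θ → ∀ Φ : (N : ℕ) → HardSphereFlow (Torus.geometry (Fin 3)) (hsDiameter σ N) (N + 1), TendstoHydroFieldsAt (fun N => localGibbsLaw σ a₀ u₀ θ₀ N (Φ N)) Φ ρ u θ 0 → ∀ t : ℝ, 0 < t → t < T → (∀ s ∈ Icc 0 t, ∀ x, 2 * ρ s x * σ ^ 3 < η₁) → ∀ (γ C : ℝ) (φ : ℕ → T3 → ℝ), 0 < γ → γ ≤ 1 / 15 → ((∀ N, Literature.Analysis.FunctionSpaces.Torus.IsSmooth (φ N)) ∧ (∀ N y, 0 ≤ φ N y) ∧ (∀ N, ∫ y, φ N y = 1) ∧ (∀ (N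 : ℕ) y, ((N : ℝ) + 1) ^ (-γ) ≤ Torus.euclidDist y 0 → φ N y = 0) ∧ (∀ (N : ℕ) y, φ N y ≤ C * ((N : ℝ) + 1) ^ (3 * γ)) ∧ (∀ (N : ℕ) y, ‖Literature.Analysis.FunctionSpaces.Torus.gradient (φ N) y‖ ≤ C * ((N : ℝ) + 1) ^ (4 * γ))) → ∃ κ : ℝ, κ < 1 ∧ ∃ N₀ : ℕ, ∀ N : ℕ, N₀ ≤ N → ∀ s ∈ Icc 0 t, ∀ x : T3, (∫ z, empiricalDensityField ((Φ N).flow s z) (fun y => φ N (y - x)) ∂(localGibbsLaw σ a₀ u₀ θ₀ N (Φ N))) * σ ^ 3 ≤ κ) → (∀ (a₀ θ₀ : T3 → ℝ) (u₀ : T3 → V3), Continuous a₀ → Continuous θ₀ → Continuous u₀ → (∀ x, 0 < a₀ x) → (∀ x, 0 < θ₀ x) → ∃ σ₀ : ℝ, 0 < σ₀ ∧ ∃ η₁ : ℝ, 0 < η₁ ∧ ∀ σ : ℝ, 0 < σ → σ < σ₀ → ∀ (T : ℝ) (ρ θ : ℝ → T3 → ℝ) (u : ℝ → T3 → V3), IsHardSphereEulerSolution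 σ T ρ u θ → ∀ Φ : (N : ℕ) → HardSphereFlow (Torus.geometry (Fin 3)) (hsDiameter σ N) (N + 1), TendstoHydroFieldsAt (fun N => localGibbsLaw σ a₀ u₀ θ₀ N (Φ N)) Φ ρ u θ 0 → ∀ t : ℝ, 0 < t → t < T → (∀ s ∈ Icc 0 t, ∀ x, 2 * ρ s x * σ ^ 3 < η₁) → ∀ (γ C : ℝ) (φ : ℕ → T3 → ℝ), 0 < γ → γ ≤ 1 / 15 → ((∀ N, Literature.Analysis.FunctionSpaces.Torus.IsSmooth (φ N)) ∧ (∀ N y, 0 ≤ φ N y) ∧ (∀ N, ∫ y, φ N y = 1) ∧ (∀ (N : ℕ) y, ((N : ℝ) + 1) ^ (-γ) ≤ Torus.euclidDist y 0 → φ N y = 0) ∧ (∀ (N : ℕ) y, φ N y ≤ C * ((N : ℝ) + 1) ^ (3 * γ)) ∧ (∀ (N : ℕ) y, ‖Literature.Analysis.FunctionSpaces.Torus.gradient (φ N) y‖ ≤ C * ((N : ℝ) + 1) ^ (4 * γ))) → ∃ A : ℝ, ∃ N₀ : ℕ, ∀ N : ℕ, N₀ ≤ N → ∀ s ∈ Icc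 0 t, ∀ x : T3, MemLp (fun z => empiricalDensityField ((Φ N).flow s z) (fun y => φ N (y - x))) 2 (localGibbsLaw σ a₀ u₀ θ₀ N (Φ N)) ∧ variance (fun z => empiricalDensityField ((Φ N).flow s z) (fun y => φ N (y - x))) (localGibbsLaw σ a₀ u₀ θ₀ N (Φ N)) ≤ A * ((N : ℝ) + 1) ^ (3 * γ - 1)) → ∀ (a₀ θ₀ : T3 → ℝ) (u₀ : T3 → V3), Continuous a₀ → Continuous θ₀ → Continuous u₀ → (∀ x, 0 < a₀ x) → (∀ x, 0 < θ₀ x) → ∃ σ₀ : ℝ, 0 < σ₀ ∧ ∃ η₁ : ℝ, 0 < η₁ ∧ ∀ σ : ℝ, 0 < σ → σ < σ₀ → ∀ (T : ℝ) (ρ θ : ℝ → T3 → ℝ) (u : ℝ → T3 → V3), IsHardSphereEulerSolution σ T ρ u θ → ∀ Φ : (N : ℕ) → HardSphereFlow (Torus.geometry (Fin 3)) (hsDiameter σ N) (N + 1), TendstoHydroFieldsAt (fun N => localGibbsLaw σ a₀ u₀ θ₀ N (Φ N)) Φ ρ u θ 0 → ∀ t : ℝ, 0 < t → t < T → (∀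 s ∈ Icc 0 t, ∀ x, 2 * ρ s x * σ ^ 3 < η₁) → PartTwoAt σ a₀ θ₀ u₀ Φ t := by
  intro hF hC hV a₀ θ₀ u₀ ha hθ hu ha0 hθ0
  have hP : NiceProfiles a₀ θ₀ u₀ := ⟨ha, hθ, hu, ha0, hθ0⟩
  obtain ⟨σ₁, hσ₁, η₁, hη₁, H1⟩ := hF a₀ θ₀ u₀ ha hθ hu ha0 hθ0
  obtain ⟨σ₂, hσ₂, η₂, hη₂, H2⟩ := hC a₀ θ₀ u₀ ha hθ hu ha0 hθ0
  obtain ⟨σ₃, hσ₃, η₃, hη₃, H3⟩ := hV a₀ θ₀ u₀ ha hθ hu ha0 hθ0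
  refine ⟨min (min σ₁ σ₂) (min σ₃ (1 / 2)), lt_min (lt_min hσ₁ hσ₂) (lt_min hσ₃ one_half_pos),
    min (min η₁ η₂) η₃, lt_min (lt_min hη₁ hη₂) hη₃, ?_⟩
  intro σ hσ hσlt T ρ θ u hsol Φ hLLN t ht htT hdil
  simp only [lt_min_iff] at hσlt hdil
  obtain ⟨⟨hs1, hs2⟩, hs3, hshalf⟩ := hσlt
  intro γ C φ hγ hγ' hadm
  have hFl := H1 σ hσ hs1 T ρ θ u hsol Φ hLLN t ht htT (fun s hs x => (hdil s hs x).1.1) γ C φ hγ hγ' hadm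
  have hCe := H2 σ hσ hs2 T ρ θ u hsol Φ hLLN t ht htT (fun s hs x => (hdil s hs x).1.2) γ C φ hγ hγ' hadm
  have hVa := H3 σ hσ hs3 T ρ θ u hsol Φ hLLN t ht htT (fun s hs x => (hdil s hs x).2) γ C φ hγ hγ' hadm
  exact stub_partTwo_of_meanVariance σ a₀ θ₀ u₀ Φ t hσ hshalf.le hP ht (energyBound_of_lln hLLN) γ C φ hγ hγ'
    hadm hFl hCe hVa

/-! ## Component (i): size × concentration -/

/-- **Component (i) under the crux prefix from the two OPEN (i)-stubs of the line** (registered anchor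
`partOne_of_farTailAll_occupationVariance`) — `stub_farTailAll` (SIZE: far tails in
the mean at all levels, `FarTailAllAt`; ⇐ stmt-14415 by `farTailAll_of_gaussianTails`) and `stub_occupationVariance`
(CONCENTRATION: `Var_{P_N} occ_K → 0` for every level `K`), written out verbatim as hypotheses — through the LANDED
`stub_partOne_of_varianceTails` (p145949 = `stub_occupationInProb_of_variance` ∘ `stub_partOne_of_occupation`).
Thresholds `σ₀ := min (min σ₅ σ₆) (1/2)`, `η₁ := min η₅ η₆`. -/
theorem partOne_of_farTailAll_occupationVariance : (∀ (a₀ θ₀ : T3 → ℝ) (u₀ : T3 → V3), Continuous a₀ → Continuous θ₀ → Continuous u₀ → (∀ x, 0 < a₀ x) → (∀ x, 0 < θ₀ x) → ∃ σ₀ : ℝ, 0 < σ₀ ∧ ∃ η₁ : ℝ, 0 < η₁ ∧ ∀ σ : ℝ, 0 < σ → σ < σ₀ → ∀ (T : ℝ) (ρ θ : ℝ → T3 → ℝ) (u : ℝ → T3 → V3), IsHardSphereEulerSolution σ T ρ u θ → ∀ Φ : (N : ℕ) → HardSphereFlow (Torus.geometry (Fin 3)) (hsDiameter σ N) (N + 1),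 TendstoHydroFieldsAt (fun N => localGibbsLaw σ a₀ u₀ θ₀ N (Φ N)) Φ ρ u θ 0 → ∀ t : ℝ, 0 < t → t < T → (∀ s ∈ Icc 0 t, ∀ x, 2 * ρ s x * σ ^ 3 < η₁) → FarTailAllAt σ a₀ θ₀ u₀ Φ t) → (∀ (a₀ θ₀ : T3 → ℝ) (u₀ : T3 → V3), Continuous a₀ → Continuous θ₀ → Continuous u₀ → (∀ x, 0 < a₀ x) → (∀ x, 0 < θ₀ x) → ∃ σ₀ : ℝ, 0 < σ₀ ∧ ∃ η₁ : ℝ, 0 < η₁ ∧ ∀ σ : ℝ, 0 < σ → σ < σ₀ → ∀ (T : ℝ) (ρ θ : ℝ → T3 → ℝ) (u : ℝ → T3 → V3), IsHardSphereEulerSolution σ T ρ u θ → ∀ Φ : (N : ℕ) → HardSphereFlow (Torus.geometry (Fin 3)) (hsDiameter σ N) (N + 1), TendstoHydroFieldsAt (fun N => localGibbsLaw σ a₀ u₀ θ₀ N (Φ N)) Φ ρ u θ 0 → ∀ t : ℝ, 0 < t → t < T → (∀ s ∈ Icc 0 t, ∀ x, 2 * ρ s x * σ ^ 3 < η₁)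 → ∀ K : ℝ, Tendsto (fun N : ℕ => variance (fun z => (∫⁻ s in Icc 0 t, ENNReal.ofReal (frac K ((Φ N).flow s z))).toReal) (localGibbsLaw σ a₀ u₀ θ₀ N (Φ N))) atTop (𝓝 0)) → ∀ (a₀ θ₀ : T3 → ℝ) (u₀ : T3 → V3), Continuous a₀ → Continuous θ₀ → Continuous u₀ → (∀ x, 0 < a₀ x) → (∀ x, 0 < θ₀ x) → ∃ σ₀ : ℝ, 0 < σ₀ ∧ ∃ η₁ : ℝ, 0 < η₁ ∧ ∀ σ : ℝ, 0 < σ → σ < σ₀ → ∀ (T : ℝ) (ρ θ : ℝ → T3 → ℝ) (u : ℝ → T3 → V3), IsHardSphereEulerSolution σ T ρ u θ → ∀ Φ : (N : ℕ) → HardSphereFlow (Torus.geometry (Fin 3)) (hsDiameter σ N) (N + 1), TendstoHydroFieldsAt (fun N => localGibbsLaw σ a₀ u₀ θ₀ N (Φ N)) Φ ρ u θ 0 → ∀ t : ℝ, 0 < t → t < T → (∀ s ∈ Icc 0 t, ∀ x, 2 * ρ s x * σ ^ 3 < η₁) → PartOneAt σ a₀ θ₀ u₀ Φ t := by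
  intro h5 h6 a₀ θ₀ u₀ ha hθ hu ha0 hθ0
  have hP : NiceProfiles a₀ θ₀ u₀ := ⟨ha, hθ, hu, ha0, hθ0⟩
  obtain ⟨σ₅, hσ₅, η₅, hη₅, H5⟩ := h5 a₀ θ₀ u₀ ha hθ hu ha0 hθ0
  obtain ⟨σ₆, hσ₆, η₆, hη₆, H6⟩ := h6 a₀ θ₀ u₀ ha hθ hu ha0 hθ0
  refine ⟨min (min σ₅ σ₆) (1 / 2), lt_min (lt_min hσ₅ hσ₆) one_half_pos, min η₅ η₆, lt_min hη₅ hη₆, ?_⟩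
  intro σ hσ hσlt T ρ θ u hsol Φ hLLN t ht htT hdil
  simp only [lt_min_iff] at hσlt hdil
  obtain ⟨⟨hs5, hs6⟩, hshalf⟩ := hσlt
  have hFar : FarTailAllAt σ a₀ θ₀ u₀ Φ t :=
    H5 σ hσ hs5 T ρ θ u hsol Φ hLLN t ht htT (fun s hs x => (hdil s hs x).1)
  have hVar := H6 σ hσ hs6 T ρ θ u hsol Φ hLLN t ht htT (fun s hs x => (hdil s hs x).2)
  exact stub_partOne_of_varianceTails σ a₀ θ₀ u₀ Φ t hσ hshalf.le hP ht hVar hFar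

/-! ## The skeleton theorem, importable -/

/-- **THE SKELETON THEOREM OF THE LINE `meso-chebyshev-window`, importable.**
The five OPEN registered stubs of skeleton r1 — `stub_meanFloor`, `stub_meanCeiling`, `stub_mesoVariance` (component (ii)),
`stub_farTailAll`, `stub_occupationVariance` (component (i)), written out verbatim as hypotheses, in this order — imply the
crux decl `StiffCollisionalRelaxation.AprioriBounds` BY NAME; the two provable stubs enter as the landed theorems
`stub_partTwo_of_meanVariance` (p145137) and `stub_partOne_of_varianceTails` (p145949).  Thresholds: minima of the two
components' thresholds (`aprioriBounds_of_partOne_partTwo`). -/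
theorem AprioriBounds_of_meso_stubs
    (h1 : ∀ (a₀ θ₀ : T3 → ℝ) (u₀ : T3 → V3), Continuous a₀ → Continuous θ₀ → Continuous u₀ → (∀ x, 0 < a₀ x) → (∀ x, 0 < θ₀ x) → ∃ σ₀ : ℝ, 0 < σ₀ ∧ ∃ η₁ : ℝ, 0 < η₁ ∧ ∀ σ : ℝ, 0 < σ → σ < σ₀ → ∀ (T : ℝ) (ρ θ : ℝ → T3 → ℝ) (u : ℝ → T3 → V3), IsHardSphereEulerSolution σ T ρ u θ → ∀ Φ : (N : ℕ) → HardSphereFlow (Torus.geometry (Fin 3)) (hsDiameter σ N) (N + 1), TendstoHydroFieldsAt (fun N => localGibbsLaw σ a₀ u₀ θ₀ N (Φ N)) Φ ρ u θ 0 → ∀ t : ℝ, 0 < t → t < T → (∀ s ∈ Icc 0 t, ∀ x, 2 * ρ s x * σ ^ 3 < η₁) → ∀ (γ C : ℝ) (φ : ℕ → T3 → ℝ), 0 < γ → γ ≤ 1 / 15 → ((∀ N, Literature.Analysis.FunctionSpaces.Torus.IsSmooth (φ N)) ∧ (∀ N y, 0 ≤ φ N y) ∧ (∀ N, ∫ y,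 φ N y = 1) ∧ (∀ (N : ℕ) y, ((N : ℝ) + 1) ^ (-γ) ≤ Torus.euclidDist y 0 → φ N y = 0) ∧ (∀ (N : ℕ) y, φ N y ≤ C * ((N : ℝ) + 1) ^ (3 * γ)) ∧ (∀ (N : ℕ) y, ‖Literature.Analysis.FunctionSpaces.Torus.gradient (φ N) y‖ ≤ C * ((N : ℝ) + 1) ^ (4 * γ))) → ∃ m : ℝ, 0 < m ∧ ∃ N₀ : ℕ, ∀ N : ℕ, N₀ ≤ N → ∀ s ∈ Icc 0 t, ∀ x : T3, m ≤ ∫ z, empiricalDensityField ((Φ N).flow s z) (fun y => φ N (y - x)) ∂(localGibbsLaw σ a₀ u₀ θ₀ N (Φ N)))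
    (h2 : ∀ (a₀ θ₀ : T3 → ℝ) (u₀ : T3 → V3), Continuous a₀ → Continuous θ₀ → Continuous u₀ → (∀ x, 0 < a₀ x) → (∀ x, 0 < θ₀ x) → ∃ σ₀ : ℝ, 0 < σ₀ ∧ ∃ η₁ : ℝ, 0 < η₁ ∧ ∀ σ : ℝ, 0 < σ → σ < σ₀ → ∀ (T : ℝ) (ρ θ : ℝ → T3 → ℝ) (u : ℝ → T3 → V3), IsHardSphereEulerSolution σ T ρ u θ → ∀ Φ : (N : ℕ) → HardSphereFlow (Torus.geometry (Fin 3)) (hsDiameter σ N) (N + 1), TendstoHydroFieldsAt (fun N => localGibbsLaw σ a₀ u₀ θ₀ N (Φ N)) Φ ρ u θ 0 → ∀ t : ℝ, 0 < t → t < T → (∀ s ∈ Icc 0 t, ∀ x, 2 * ρ s x * σ ^ 3 < η₁) → ∀ (γ C : ℝ) (φ : ℕ → T3 → ℝ), 0 < γ → γ ≤ 1 / 15 → ((∀ N, Literature.Analysis.FunctionSpaces.Torus.IsSmooth (φ N)) ∧ (∀ N y, 0 ≤ φ N y) ∧ (∀ N, ∫ y, φ N y = 1) ∧ (∀ (N :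 ℕ) y, ((N : ℝ) + 1) ^ (-γ) ≤ Torus.euclidDist y 0 → φ N y = 0) ∧ (∀ (N : ℕ) y, φ N y ≤ C * ((N : ℝ) + 1) ^ (3 * γ)) ∧ (∀ (N : ℕ) y, ‖Literature.Analysis.FunctionSpaces.Torus.gradient (φ N) y‖ ≤ C * ((N : ℝ) + 1) ^ (4 * γ))) → ∃ κ : ℝ, κ < 1 ∧ ∃ N₀ : ℕ, ∀ N : ℕ, N₀ ≤ N → ∀ s ∈ Icc 0 t, ∀ x : T3, (∫ z, empiricalDensityField ((Φ N).flow s z) (fun y => φ N (y - x)) ∂(localGibbsLaw σ a₀ u₀ θ₀ N (Φ N))) * σ ^ 3 ≤ κ)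
    (h3 : ∀ (a₀ θ₀ : T3 → ℝ) (u₀ : T3 → V3), Continuous a₀ → Continuous θ₀ → Continuous u₀ → (∀ x, 0 < a₀ x) → (∀ x, 0 < θ₀ x) → ∃ σ₀ : ℝ, 0 < σ₀ ∧ ∃ η₁ : ℝ, 0 < η₁ ∧ ∀ σ : ℝ, 0 < σ → σ < σ₀ → ∀ (T : ℝ) (ρ θ : ℝ → T3 → ℝ) (u : ℝ → T3 → V3), IsHardSphereEulerSolution σ T ρ u θ → ∀ Φ : (N : ℕ) → HardSphereFlow (Torus.geometry (Fin 3)) (hsDiameter σ N) (N + 1), TendstoHydroFieldsAt (fun N => localGibbsLaw σ a₀ u₀ θ₀ N (Φ N)) Φ ρ u θ 0 → ∀ t : ℝ, 0 < t → t < T → (∀ s ∈ Icc 0 t, ∀ x, 2 * ρ s x * σ ^ 3 < η₁) → ∀ (γ C : ℝ) (φ : ℕ → T3 → ℝ), 0 < γ → γ ≤ 1 / 15 → ((∀ N, Literature.Analysis.FunctionSpaces.Torus.IsSmooth (φ N)) ∧ (∀ N y, 0 ≤ φ N y) ∧ (∀ N, ∫ y, φ N y = 1) ∧ (∀ (N :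 ℕ) y, ((N : ℝ) + 1) ^ (-γ) ≤ Torus.euclidDist y 0 → φ N y = 0) ∧ (∀ (N : ℕ) y, φ N y ≤ C * ((N : ℝ) + 1) ^ (3 * γ)) ∧ (∀ (N : ℕ) y, ‖Literature.Analysis.FunctionSpaces.Torus.gradient (φ N) y‖ ≤ C * ((N : ℝ) + 1) ^ (4 * γ))) → ∃ A : ℝ, ∃ N₀ : ℕ, ∀ N : ℕ, N₀ ≤ N → ∀ s ∈ Icc 0 t, ∀ x : T3, MemLp (fun z => empiricalDensityField ((Φ N).flow s z) (fun y => φ N (y - x))) 2 (localGibbsLaw σ a₀ u₀ θ₀ N (Φ N)) ∧ variance (fun z => empiricalDensityField ((Φ N).flow s z) (fun y => φ N (y - x))) (localGibbsLaw σ a₀ u₀ θ₀ N (Φ N)) ≤ A * ((N : ℝ) + 1) ^ (3 * γ - 1))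
    (h5 : ∀ (a₀ θ₀ : T3 → ℝ) (u₀ : T3 → V3), Continuous a₀ → Continuous θ₀ → Continuous u₀ → (∀ x, 0 < a₀ x) → (∀ x, 0 < θ₀ x) → ∃ σ₀ : ℝ, 0 < σ₀ ∧ ∃ η₁ : ℝ, 0 < η₁ ∧ ∀ σ : ℝ, 0 < σ → σ < σ₀ → ∀ (T : ℝ) (ρ θ : ℝ → T3 → ℝ) (u : ℝ → T3 → V3), IsHardSphereEulerSolution σ T ρ u θ → ∀ Φ : (N : ℕ) → HardSphereFlow (Torus.geometry (Fin 3)) (hsDiameter σ N) (N + 1), TendstoHydroFieldsAt (fun N => localGibbsLaw σ a₀ u₀ θ₀ N (Φ N)) Φ ρ u θ 0 → ∀ t : ℝ, 0 < t → t < T → (∀ s ∈ Icc 0 t, ∀ x, 2 * ρ s x * σ ^ 3 < η₁) → FarTailAllAt σ a₀ θ₀ u₀ Φ t)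
    (h6 : ∀ (a₀ θ₀ : T3 → ℝ) (u₀ : T3 → V3), Continuous a₀ → Continuous θ₀ → Continuous u₀ → (∀ x, 0 < a₀ x) → (∀ x, 0 < θ₀ x) → ∃ σ₀ : ℝ, 0 < σ₀ ∧ ∃ η₁ : ℝ, 0 < η₁ ∧ ∀ σ : ℝ, 0 < σ → σ < σ₀ → ∀ (T : ℝ) (ρ θ : ℝ → T3 → ℝ) (u : ℝ → T3 → V3), IsHardSphereEulerSolution σ T ρ u θ → ∀ Φ : (N : ℕ) → HardSphereFlow (Torus.geometry (Fin 3)) (hsDiameter σ N) (N + 1), TendstoHydroFieldsAt (fun N => localGibbsLaw σ a₀ u₀ θ₀ N (Φ N)) Φ ρ u θ 0 → ∀ t : ℝ, 0 < t → t < T → (∀ s ∈ Icc 0 t, ∀ x, 2 * ρ s x * σ ^ 3 < η₁) → ∀ K : ℝ, Tendsto (fun N : ℕ => variance (fun z => (∫⁻ s in Icc 0 t, ENNReal.ofReal (frac K ((Φ N).flow s z))).toReal) (localGibbsLaw σ a₀ u₀ θ₀ N (Φ N))) atTop (𝓝 0)) :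
    Summit.AtomisticToContinuum.HydrodynamicLimit.Theses.StiffCollisionalRelaxation.AprioriBounds :=
  aprioriBounds_of_partOne_partTwo (partOne_of_farTailAll_occupationVariance h5 h6)
    (partTwo_of_meanBands_mesoVariance h1 h2 h3)

/-- The `CollisionIsometryCLT` twin of `AprioriBounds_of_meso_stubs` (the two crux decls are one `Prop`,
`AprioriBoundsNegative.aprioriBoundsPreShock_iff`). -/
theorem AprioriBoundsPreShock_of_meso_stubs
    (h1 : ∀ (a₀ θ₀ : T3 → ℝ) (u₀ : T3 → V3), Continuous a₀ → Continuous θ₀ → Continuous u₀ → (∀ x, 0 < a₀ x) → (∀ x, 0 < θ₀ x) → ∃ σ₀ : ℝ, 0 < σ₀ ∧ ∃ η₁ : ℝ, 0 < η₁ ∧ ∀ σ : ℝ, 0 < σ → σ < σ₀ → ∀ (T : ℝ) (ρ θ : ℝ → T3 → ℝ) (u : ℝ → T3 → V3), IsHardSphereEulerSolution σ T ρ u θ → ∀ Φ : (N : ℕ) → HardSphereFlow (Torus.geometry (Fin 3)) (hsDiameter σ N) (N + 1), TendstoHydroFieldsAt (fun N => localGibbsLaw σ a₀ u₀ θ₀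 N (Φ N)) Φ ρ u θ 0 → ∀ t : ℝ, 0 < t → t < T → (∀ s ∈ Icc 0 t, ∀ x, 2 * ρ s x * σ ^ 3 < η₁) → ∀ (γ C : ℝ) (φ : ℕ → T3 → ℝ), 0 < γ → γ ≤ 1 / 15 → ((∀ N, Literature.Analysis.FunctionSpaces.Torus.IsSmooth (φ N)) ∧ (∀ N y, 0 ≤ φ N y) ∧ (∀ N, ∫ y, φ N y = 1) ∧ (∀ (N : ℕ) y, ((N : ℝ) + 1) ^ (-γ) ≤ Torus.euclidDist y 0 → φ N y = 0) ∧ (∀ (N : ℕ) y, φ N y ≤ C * ((N : ℝ) + 1) ^ (3 * γ)) ∧ (∀ (N : ℕ) y, ‖Literature.Analysis.FunctionSpaces.Torus.gradient (φ N) y‖ ≤ C * ((N : ℝ) + 1) ^ (4 * γ))) → ∃ m : ℝ, 0 < m ∧ ∃ N₀ : ℕ, ∀ N : ℕ, N₀ ≤ N → ∀ s ∈ Icc 0 t, ∀ x : T3, m ≤ ∫ z, empiricalDensityField ((Φ N).flow s z) (fun y => φ N (y - x)) ∂(localGibbsLaw σ a₀ u₀ θ₀ N (Φ N)))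
    (h2 : ∀ (a₀ θ₀ : T3 → ℝ) (u₀ : T3 → V3), Continuous a₀ → Continuous θ₀ → Continuous u₀ → (∀ x, 0 < a₀ x) → (∀ x, 0 < θ₀ x) → ∃ σ₀ : ℝ, 0 < σ₀ ∧ ∃ η₁ : ℝ, 0 < η₁ ∧ ∀ σ : ℝ, 0 < σ → σ < σ₀ → ∀ (T : ℝ) (ρ θ : ℝ → T3 → ℝ) (u : ℝ → T3 → V3), IsHardSphereEulerSolution σ T ρ u θ → ∀ Φ : (N : ℕ) → HardSphereFlow (Torus.geometry (Fin 3)) (hsDiameter σ N) (N + 1), TendstoHydroFieldsAt (fun N => localGibbsLaw σ a₀ u₀ θ₀ N (Φ N)) Φ ρ u θ 0 → ∀ t : ℝ, 0 < t → t < T → (∀ s ∈ Icc 0 t, ∀ x, 2 * ρ s x * σ ^ 3 < η₁) → ∀ (γ C : ℝ) (φ : ℕ → T3 → ℝ), 0 < γ → γ ≤ 1 / 15 → ((∀ N, Literature.Analysis.FunctionSpaces.Torus.IsSmooth (φ N)) ∧ (∀ N y, 0 ≤ φ N y) ∧ (∀ N, ∫ y, φ N y = 1) ∧ (∀ (N :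 ℕ) y, ((N : ℝ) + 1) ^ (-γ) ≤ Torus.euclidDist y 0 → φ N y = 0) ∧ (∀ (N : ℕ) y, φ N y ≤ C * ((N : ℝ) + 1) ^ (3 * γ)) ∧ (∀ (N : ℕ) y, ‖Literature.Analysis.FunctionSpaces.Torus.gradient (φ N) y‖ ≤ C * ((N : ℝ) + 1) ^ (4 * γ))) → ∃ κ : ℝ, κ < 1 ∧ ∃ N₀ : ℕ, ∀ N : ℕ, N₀ ≤ N → ∀ s ∈ Icc 0 t, ∀ x : T3, (∫ z, empiricalDensityField ((Φ N).flow s z) (fun y => φ N (y - x)) ∂(localGibbsLaw σ a₀ u₀ θ₀ N (Φ N))) * σ ^ 3 ≤ κ)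
    (h3 : ∀ (a₀ θ₀ : T3 → ℝ) (u₀ : T3 → V3), Continuous a₀ → Continuous θ₀ → Continuous u₀ → (∀ x, 0 < a₀ x) → (∀ x, 0 < θ₀ x) → ∃ σ₀ : ℝ, 0 < σ₀ ∧ ∃ η₁ : ℝ, 0 < η₁ ∧ ∀ σ : ℝ, 0 < σ → σ < σ₀ → ∀ (T : ℝ) (ρ θ : ℝ → T3 → ℝ) (u : ℝ → T3 → V3), IsHardSphereEulerSolution σ T ρ u θ → ∀ Φ : (N : ℕ) → HardSphereFlow (Torus.geometry (Fin 3)) (hsDiameter σ N) (N + 1), TendstoHydroFieldsAt (fun N => localGibbsLaw σ a₀ u₀ θ₀ N (Φ N)) Φ ρ u θ 0 → ∀ t : ℝ, 0 < t → t < T → (∀ s ∈ Icc 0 t, ∀ x, 2 * ρ s x * σ ^ 3 < η₁) → ∀ (γ C : ℝ) (φ : ℕ → T3 → ℝ), 0 < γ → γ ≤ 1 / 15 → ((∀ N, Literature.Analysis.FunctionSpaces.Torus.IsSmooth (φ N)) ∧ (∀ N y, 0 ≤ φ N y) ∧ (∀ N, ∫ y, φ N y = 1) ∧ (∀ (N :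 ℕ) y, ((N : ℝ) + 1) ^ (-γ) ≤ Torus.euclidDist y 0 → φ N y = 0) ∧ (∀ (N : ℕ) y, φ N y ≤ C * ((N : ℝ) + 1) ^ (3 * γ)) ∧ (∀ (N : ℕ) y, ‖Literature.Analysis.FunctionSpaces.Torus.gradient (φ N) y‖ ≤ C * ((N : ℝ) + 1) ^ (4 * γ))) → ∃ A : ℝ, ∃ N₀ : ℕ, ∀ N : ℕ, N₀ ≤ N → ∀ s ∈ Icc 0 t, ∀ x : T3, MemLp (fun z => empiricalDensityField ((Φ N).flow s z) (fun y => φ N (y - x))) 2 (localGibbsLaw σ a₀ u₀ θ₀ N (Φ N)) ∧ variance (fun z => empiricalDensityField ((Φ N).flow s z) (fun y => φ N (y - x))) (localGibbsLaw σ a₀ u₀ θ₀ N (Φ N)) ≤ A * ((N : ℝ) + 1) ^ (3 * γ - 1))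
    (h5 : ∀ (a₀ θ₀ : T3 → ℝ) (u₀ : T3 → V3), Continuous a₀ → Continuous θ₀ → Continuous u₀ → (∀ x, 0 < a₀ x) → (∀ x, 0 < θ₀ x) → ∃ σ₀ : ℝ, 0 < σ₀ ∧ ∃ η₁ : ℝ, 0 < η₁ ∧ ∀ σ : ℝ, 0 < σ → σ < σ₀ → ∀ (T : ℝ) (ρ θ : ℝ → T3 → ℝ) (u : ℝ → T3 → V3), IsHardSphereEulerSolution σ T ρ u θ → ∀ Φ : (N : ℕ) → HardSphereFlow (Torus.geometry (Fin 3)) (hsDiameter σ N) (N + 1), TendstoHydroFieldsAt (fun N => localGibbsLaw σ a₀ u₀ θ₀ N (Φ N)) Φ ρ u θ 0 → ∀ t : ℝ, 0 < t → t < T → (∀ s ∈ Icc 0 t, ∀ x, 2 * ρ s x * σ ^ 3 < η₁) → FarTailAllAt σ a₀ θ₀ u₀ Φ t)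
    (h6 : ∀ (a₀ θ₀ : T3 → ℝ) (u₀ : T3 → V3), Continuous a₀ → Continuous θ₀ → Continuous u₀ → (∀ x, 0 < a₀ x) → (∀ x, 0 < θ₀ x) → ∃ σ₀ : ℝ, 0 < σ₀ ∧ ∃ η₁ : ℝ, 0 < η₁ ∧ ∀ σ : ℝ, 0 < σ → σ < σ₀ → ∀ (T : ℝ) (ρ θ : ℝ → T3 → ℝ) (u : ℝ → T3 → V3), IsHardSphereEulerSolution σ T ρ u θ → ∀ Φ : (N : ℕ) → HardSphereFlow (Torus.geometry (Fin 3)) (hsDiameter σ N) (N + 1), TendstoHydroFieldsAt (fun N => localGibbsLaw σ a₀ u₀ θ₀ N (Φ N)) Φ ρ u θ 0 → ∀ t : ℝ, 0 < t → t < T → (∀ s ∈ Icc 0 t, ∀ x, 2 * ρ s x * σ ^ 3 < η₁) → ∀ K : ℝ, Tendsto (fun N : ℕ => variance (fun z => (∫⁻ s in Icc 0 t, ENNReal.ofReal (frac K ((Φ N).flow s z))).toReal) (localGibbsLaw σ a₀ u₀ θ₀ N (Φ N))) atTop (𝓝 0)) :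
    Summit.AtomisticToContinuum.HydrodynamicLimit.Theses.CollisionIsometryCLT.AprioriBoundsPreShock :=
  AprioriBounds_of_meso_stubs h1 h2 h3 h5 h6

/-! ## The minimal-import capstone: 14827 ⇐ 9201 ∧ 14415 ∧ occupation variance -/

/-- **CAPSTONE (registered anchor `AprioriBounds_of_KRC_GT_occupationVariance`) — 14827 from the two pre-shock-guarded open
items 9201, 14415 and ONE new rate-free concentration statement (occupation variance).**  `GermanoSplitLES.KineticRangeControl`
(stmt-AtomisticToContinuum-9201) gives component (ii) under the crux prefix (`AdiabatCeiling.partTwo_of_kineticRangeControl`, landed);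
`UGibbsSRBRigidity.GaussianTails` (stmt-AtomisticToContinuum-14415: Gaussian velocity moments along the flow below the classical Euler
horizon) gives `FarTailAllAt` under the crux prefix (`FibreDeficitTransfer.farTailAll_of_gaussianTails`, landed); the third
hypothesis is the registered stub `stub_occupationVariance` verbatim — for every fixed level `K`, the variance under the local
Gibbs law of the time-integrated one-particle tail occupation `occ_K = ∫₀ᵗ frac_K(Φ_s ·) ds` tends to `0` (no rate, no uniformity
in `K`, no identification of a limit) — and component (i) follows by `partOne_of_farTailAll_occupationVariance`.  Supersedes
`FibreDeficitTransfer.AprioriBounds_of_KRC_GT_HLPB` (p137042), whose third hypothesis `ImplosionDichotomy.HydroLimitProfilewiseBand`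
(stmt-17372) is the per-profile CONJUNCT (circular for both consuming routes, `Lines/fibre-deficit-transfer-dead.md`); the
occupation-variance hypothesis is implied by neither the conjunct nor (i) and names no Euler field.  Thresholds by `min`
(`aprioriBounds_of_partOne_partTwo`). -/
theorem AprioriBounds_of_KRC_GT_occupationVariance : Summit.AtomisticToContinuum.HydrodynamicLimit.Theses.GermanoSplitLES.KineticRangeControl → Summit.AtomisticToContinuum.HydrodynamicLimit.Theses.UGibbsSRBRigidity.GaussianTails → (∀ (a₀ θ₀ : T3 → ℝ) (u₀ : T3 → V3), Continuous a₀ → Continuous θ₀ → Continuous u₀ → (∀ x, 0 < a₀ x) → (∀ x, 0 < θ₀ x) → ∃ σ₀ : ℝ, 0 < σ₀ ∧ ∃ η₁ : ℝ, 0 < η₁ ∧ ∀ σ : ℝ, 0 < σ → σ < σ₀ → ∀ (T : ℝ) (ρ θ : ℝ → T3 → ℝ) (u : ℝ → T3 → V3), IsHardSphereEulerSolution σ T ρ u θ → ∀ Φ : (N : ℕ) → HardSphereFlow (Torus.geometry (Fin 3)) (hsDiameter σ N) (N + 1), TendstoHydroFieldsAt (fun N => localGibbsLaw σ a₀ u₀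 θ₀ N (Φ N)) Φ ρ u θ 0 → ∀ t : ℝ, 0 < t → t < T → (∀ s ∈ Icc 0 t, ∀ x, 2 * ρ s x * σ ^ 3 < η₁) → ∀ K : ℝ, Tendsto (fun N : ℕ => variance (fun z => (∫⁻ s in Icc 0 t, ENNReal.ofReal (frac K ((Φ N).flow s z))).toReal) (localGibbsLaw σ a₀ u₀ θ₀ N (Φ N))) atTop (𝓝 0)) → Summit.AtomisticToContinuum.HydrodynamicLimit.Theses.StiffCollisionalRelaxation.AprioriBounds :=
  fun hKRC hGT h6 => aprioriBounds_of_partOne_partTwo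
    (partOne_of_farTailAll_occupationVariance (farTailAll_of_gaussianTails hGT) h6)
    (AdiabatCeiling.partTwo_of_kineticRangeControl hKRC)

/-- The `CollisionIsometryCLT` twin of `AprioriBounds_of_KRC_GT_occupationVariance`. -/
theorem AprioriBoundsPreShock_of_KRC_GT_occupationVariance : Summit.AtomisticToContinuum.HydrodynamicLimit.Theses.GermanoSplitLES.KineticRangeControl → Summit.AtomisticToContinuum.HydrodynamicLimit.Theses.UGibbsSRBRigidity.GaussianTails → (∀ (a₀ θ₀ : T3 → ℝ) (u₀ : T3 → V3), Continuous a₀ → Continuous θ₀ → Continuous u₀ → (∀ x, 0 < a₀ x) → (∀ x, 0 < θ₀ x) → ∃ σ₀ : ℝ, 0 < σ₀ ∧ ∃ η₁ : ℝ, 0 < η₁ ∧ ∀ σ : ℝ, 0 < σ → σ < σ₀ → ∀ (T : ℝ) (ρ θ : ℝ → T3 → ℝ) (u : ℝ → T3 → V3), IsHardSphereEulerSolution σ T ρ u θ → ∀ Φ : (N : ℕ) → HardSphereFlow (Torus.geometry (Fin 3)) (hsDiameter σ N) (N + 1), TendstoHydroFieldsAt (fun N => localGibbsLaw σ a₀ u₀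 θ₀ N (Φ N)) Φ ρ u θ 0 → ∀ t : ℝ, 0 < t → t < T → (∀ s ∈ Icc 0 t, ∀ x, 2 * ρ s x * σ ^ 3 < η₁) → ∀ K : ℝ, Tendsto (fun N : ℕ => variance (fun z => (∫⁻ s in Icc 0 t, ENNReal.ofReal (frac K ((Φ N).flow s z))).toReal) (localGibbsLaw σ a₀ u₀ θ₀ N (Φ N))) atTop (𝓝 0)) → Summit.AtomisticToContinuum.HydrodynamicLimit.Theses.CollisionIsometryCLT.AprioriBoundsPreShock :=
  AprioriBounds_of_KRC_GT_occupationVariance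

/-- **The (ii)-chain's bands are 9201-weak.**  `KineticRangeControl` (stmt-9201) supplies BOTH mean bands of the line — the floor
(`meanFloor_of_kineticRangeControl`, p142675) and the ceiling (`meanCeiling_of_kineticRangeControl`, p143118) — so together with
`GaussianTails` (stmt-14415), the Poisson-order variance stub `stub_mesoVariance` and the occupation-variance stub
`stub_occupationVariance` (both verbatim) it gives the crux through the line's own skeleton theorem `AprioriBounds_of_meso_stubs`.
Dominated by `AprioriBounds_of_KRC_GT_occupationVariance` (which needs no variance for (ii)); recorded to document that the two
bands cost nothing beyond 9201. -/
theorem AprioriBounds_of_KRC_GT_mesoVariance_occupationVariance : Summit.AtomisticToContinuum.HydrodynamicLimit.Theses.GermanoSplitLES.KineticRangeControl → Summit.AtomisticToContinuum.HydrodynamicLimit.Theses.UGibbsSRBRigidity.GaussianTails → (∀ (a₀ θ₀ : T3 → ℝ) (u₀ : T3 → V3), Continuous a₀ → Continuous θ₀ → Continuous u₀ → (∀ x, 0 < a₀ x) → (∀ x, 0 < θ₀ x) → ∃ σ₀ : ℝ, 0 < σ₀ ∧ ∃ η₁ : ℝ, 0 < η₁ ∧ ∀ σ : ℝ, 0 <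 σ → σ < σ₀ → ∀ (T : ℝ) (ρ θ : ℝ → T3 → ℝ) (u : ℝ → T3 → V3), IsHardSphereEulerSolution σ T ρ u θ → ∀ Φ : (N : ℕ) → HardSphereFlow (Torus.geometry (Fin 3)) (hsDiameter σ N) (N + 1), TendstoHydroFieldsAt (fun N => localGibbsLaw σ a₀ u₀ θ₀ N (Φ N)) Φ ρ u θ 0 → ∀ t : ℝ, 0 < t → t < T → (∀ s ∈ Icc 0 t, ∀ x, 2 * ρ s x * σ ^ 3 < η₁) → ∀ (γ C : ℝ) (φ : ℕ → T3 → ℝ), 0 < γ → γ ≤ 1 / 15 → ((∀ N, Literature.Analysis.FunctionSpaces.Torus.IsSmooth (φ N)) ∧ (∀ N y, 0 ≤ φ N y) ∧ (∀ N, ∫ y, φ N y = 1) ∧ (∀ (N : ℕ) y, ((N : ℝ) + 1) ^ (-γ) ≤ Torus.euclidDist y 0 → φ N y = 0) ∧ (∀ (N : ℕ) y, φ N y ≤ C * ((N : ℝ) + 1) ^ (3 * γ)) ∧ (∀ (N : ℕ) y, ‖Literature.Analysis.FunctionSpaces.Torus.gradient (φ N) y‖ ≤ C * ((N : ℝ)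 + 1) ^ (4 * γ))) → ∃ A : ℝ, ∃ N₀ : ℕ, ∀ N : ℕ, N₀ ≤ N → ∀ s ∈ Icc 0 t, ∀ x : T3, MemLp (fun z => empiricalDensityField ((Φ N).flow s z) (fun y => φ N (y - x))) 2 (localGibbsLaw σ a₀ u₀ θ₀ N (Φ N)) ∧ variance (fun z => empiricalDensityField ((Φ N).flow s z) (fun y => φ N (y - x))) (localGibbsLaw σ a₀ u₀ θ₀ N (Φ N)) ≤ A * ((N : ℝ) + 1) ^ (3 * γ - 1)) → (∀ (a₀ θ₀ : T3 → ℝ) (u₀ : T3 → V3), Continuous a₀ → Continuous θ₀ → Continuous u₀ → (∀ x, 0 < a₀ x) → (∀ x, 0 < θ₀ x) → ∃ σ₀ : ℝ, 0 < σ₀ ∧ ∃ η₁ : ℝ, 0 < η₁ ∧ ∀ σ : ℝ, 0 < σ → σ < σ₀ → ∀ (T : ℝ) (ρ θ : ℝ → T3 → ℝ) (u : ℝ → T3 → V3), IsHardSphereEulerSolution σ T ρ u θ → ∀ Φ : (N : ℕ) → HardSphereFlow (Torus.geometry (Fin 3)) (hsDiameter σ N) (N + 1), TendstoHydroFieldsAt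 (fun N => localGibbsLaw σ a₀ u₀ θ₀ N (Φ N)) Φ ρ u θ 0 → ∀ t : ℝ, 0 < t → t < T → (∀ s ∈ Icc 0 t, ∀ x, 2 * ρ s x * σ ^ 3 < η₁) → ∀ K : ℝ, Tendsto (fun N : ℕ => variance (fun z => (∫⁻ s in Icc 0 t, ENNReal.ofReal (frac K ((Φ N).flow s z))).toReal) (localGibbsLaw σ a₀ u₀ θ₀ N (Φ N))) atTop (𝓝 0)) → Summit.AtomisticToContinuum.HydrodynamicLimit.Theses.StiffCollisionalRelaxation.AprioriBounds :=
  fun hKRC hGT h3 h6 => AprioriBounds_of_meso_stubs (meanFloor_of_kineticRangeControl hKRC)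
    (meanCeiling_of_kineticRangeControl hKRC) h3 (farTailAll_of_gaussianTails hGT) h6

end Summit.AtomisticToContinuum.HydrodynamicLimit.Theorems.MesoChebyshevWindow

end
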